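import Summits.Ventures.HodgeRepro2.T6N41PlaceSatakeMain
import Summits.Ventures.HodgeRepro2.T6N41PlaceUnivD41

/-!
# T6N41PlaceSatakeToy — the Satake / L-parameter layer instantiated (Tier 6, M2; proof lane; owner t6-p4)

Three instances of `SatakeDatum` (README §10.5(ii)(c)/(d)):
* on the IS toy (`N41PlaceToy.toyInIS.toData`, the datum with `S = ∅` and an inert prime `0`): every field is
  exercised at a prime OFF `S` — `unr ≡ True`, `sat ≡ −1`, `BC = (−1, (−1)⁻¹)`; the display Rogawski §4.5 holds
  NON-vacuously (`JH 𝔓 a` is non-empty only for `a = −1`, so two characters whose principal series share an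
  unramified constituent have `a = a′ = −1`), and the derived `BCχ_eq_of_satake` evaluates on the toy to the
  identity the landed `toyInIS.BCχ_eq` postulated: `inertDatum_of_satake … = toyInIS` by `rfl`;
* on the universal chain (`N41PlaceUniv.univIn D hS`, any `S`-everywhere datum): `unr ρ := ρ.2 = ρ.1⁻¹` (the
  pairs `(a, a⁻¹)`), `sat ρ := ρ.1`, `BC = (−1, (−1)⁻¹)`; Rogawski §4.5 holds by computation (a member of
  `JH 𝔓 a = {(a, a⁻¹)}` determines `a` as its first entry), `inertDatum_of_satake … = univIn D hS` by `rfl`, and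
  the placement composes through `N41_placement_kappa_satake` (`univ_placement_kappa_satake`);
* on `toyD41` / `N43Toy.bergmanNSide.d41` (the N4 sides of the joint toy, T6N41PlaceUnivD41): the slots a v8 form
  of the witness would bind for the inert side — `d41Sat`, `d41_Sec4_5`, `d41_Harris_core`, `d41_Rogawski_core`
  (the core `d41In.toData`), and the compositions `d41_placement_kappa_satake` / `bergman_d41_placement_kappa_satake`.

No display is closed by `trivial` / `simp` / `decide` / `exact ⟨⟩` on a general datum; `#print axioms` =
{propext, Classical.choice, Quot.sound}.

§8(d): uses an L-value-free non-vanishing device: NO.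
-/

namespace Summit.Ventures.HodgeRepro2.T6

/-! ### The IS toy: an inert prime off `S` -/

namespace N41PlaceToy

/-- The Satake layer on the IS toy's core: every representation unramified, `sat ≡ −1` (the only `a` with
`JH 𝔓 a ≠ ∅`), LR's `BC(π_v) = (−1, (−1)⁻¹)`. -/
@[reducible] noncomputable def toySatIS : SatakeDatum toyInIS.toData where
  unr := fun _ _ => True
  π_unr := fun _ _ _ => trivial
  sat := fun _ _ => -1
  sat_spec := fun _ ρ _ => by
    change ρ ∈ (if ((-1 : ℂˣ)) = -1 then (Set.univ : Set (ℂˣ × ℂˣ)) else ∅)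
    rw [if_pos rfl]
    exact Set.mem_univ _
  BC := fun _ => (-1, (-1)⁻¹)
  BCχ_def := fun 𝔓 h => by
    have h0 : 𝔓 = 0 := h
    subst h0
    simp [InertDatum.toData, toyInIS, toyPlIS]
  BC_sat := fun _ _ _ => rfl

/-- Rogawski §4.5 on the IS toy, NOT vacuous: `JH 𝔓 a` is non-empty only for `a = −1`, so `a = a′ = −1`. -/
theorem toyIS_Sec4_5 : Hyp.Rogawski1990_Sec4_5_Unramified toySatIS := by
  intro 𝔓 _ a a' ρ _ ha ha'
  change ρ ∈ (if a = -1 then (Set.univ : Set (ℂˣ × ℂˣ)) else ∅) at ha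
  change ρ ∈ (if a' = -1 then (Set.univ : Set (ℂˣ × ℂˣ)) else ∅) at ha'
  by_cases h : a = -1
  · by_cases h' : a' = -1
    · exact Or.inl (h'.trans h.symm)
    · rw [if_neg h'] at ha'
      exact ha'.elim
  · rw [if_neg h] at ha
    exact ha.elim

/-- Harris II (2.2.5)(b) on the IS toy's core (the landed `toyIS_Harris`, read on the core). -/
theorem toyIS_Harris_core : Hyp.HarrisII2007_Prop2_2_5_b_core toyInIS.toData := toyIS_Harris

/-- Rogawski §11.4 on the IS toy's core (the landed `toyIS_Rogawski`, read on the core). -/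
theorem toyIS_Rogawski_core : Hyp.Rogawski1990_Sec11_4_BC_core toyInIS.toData := toyIS_Rogawski

/-- The inert datum REBUILT from the core and the Satake layer is the landed `toyInIS`: its compat field is now
the theorem `BCχ_eq_of_satake`. -/
theorem toyIS_inertDatum_of_satake_eq :
    N41Place.inertDatum_of_satake toyInIS.toData toySatIS toyIS_Sec4_5 toyIS_Harris_core toyIS_Rogawski_core =
      toyInIS := rfl

/-- The derived identity, evaluated on the IS toy at its inert prime: `(1, 1) = ((−1)(−1), (−1)(−1))`. -/
theorem toyIS_BCχ_eq_of_satake :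
    toyPlIS.BCχ 0 = toyInIS.twist 0 (toyInIS.BCrog 0 (toyInIS.π false)) (toyInIS.ξV 0) :=
  N41Place.BCχ_eq_of_satake toyInIS.toData toySatIS toyIS_Sec4_5 toyIS_Harris_core toyIS_Rogawski_core 0 rfl
    (by simp [toyDatumIS])

end N41PlaceToy

/-! ### The universal chain and the joint toy's sides -/

namespace N41PlaceUniv

open N42ToyNSide

variable {ι : Type}

/-- The Satake layer on the universal chain's core: a pair is unramified iff it is `(a, a⁻¹)`, its Satake
parameter is its first entry, LR's `BC(π_v) = (−1, (−1)⁻¹)`. -/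
@[reducible] noncomputable def univSat (D : DoublingLDatum ι) (hS : ∀ v, v ∈ D.S) :
    SatakeDatum (univIn D hS).toData where
  unr := fun _ ρ => ρ.2 = ρ.1⁻¹
  π_unr := fun _ _ _ => rfl
  sat := fun _ ρ => ρ.1
  sat_spec := fun _ ρ h => by
    change ρ = (ρ.1, ρ.1⁻¹)
    exact Prod.ext rfl h
  BC := fun _ => (-1, (-1)⁻¹)
  BCχ_def := fun _ _ => by simp [InertDatum.toData, univIn, univPl]
  BC_sat := fun _ _ _ => rfl

section univ

variable (D : DoublingLDatum ι) (hS : ∀ v, v ∈ D.S)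

/-- Rogawski §4.5 on the chain, by computation (not vacuous): a member of `JH 𝔓 a = {(a, a⁻¹)}` determines `a`
as its first entry, so `a′ = a`. -/
theorem univ_Sec4_5 : Hyp.Rogawski1990_Sec4_5_Unramified (univSat D hS) := by
  intro 𝔓 _ a a' ρ _ ha ha'
  change ρ = (a, a⁻¹) at ha
  change ρ = (a', a'⁻¹) at ha'
  exact Or.inl (congrArg Prod.fst (ha'.symm.trans ha))

/-- Harris II (2.2.5)(b) on the chain's core. -/
theorem univ_Harris_core : Hyp.HarrisII2007_Prop2_2_5_b_core (univIn D hS).toData := univ_Harris D hS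

/-- Rogawski §11.4 on the chain's core. -/
theorem univ_Rogawski_core : Hyp.Rogawski1990_Sec11_4_BC_core (univIn D hS).toData := univ_Rogawski D hS

/-- The inert datum rebuilt from the chain's core and Satake layer is `univIn D hS`. -/
theorem univ_inertDatum_of_satake_eq :
    N41Place.inertDatum_of_satake (univIn D hS).toData (univSat D hS) (univ_Sec4_5 D hS)
      (univ_Harris_core D hS) (univ_Rogawski_core D hS) = univIn D hS := rfl

include hS in
/-- **The placement (P7) composed on the chain through the Satake layer:** `N41_placement_kappa_satake` with
the core `(univIn D hS).toData`, the Satake layer `univSat D hS`, the EIGHT displays and the residual — the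
compat field `BCχ_eq` is not among the binders. -/
theorem univ_placement_kappa_satake : ∀ v ∉ D.S, ∀ s : ℂ, D.Lv v s = D.g₁ v s * D.g₂ v s :=
  N41Place.N41_placement_kappa_satake D (univPl D hS) (univIn D hS).toData (univSat D hS) (univ_Sec4_5 D hS)
    (univ_Harris_core D hS) (univ_Rogawski_core D hS) (univSp D hS) (univLQ D hS) (univKd D hS)
    (univ_LR7 D hS) (univ_Bump D hS) (univ_Minguez D hS) (univ_Bump451 D hS) (univ_Rao D hS)
    (univ_dich D hS) (univ_kappa' D hS)

end univ

/-- The Satake layer on `toyD41` (the core of the `InA` / `InB` slot). -/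
@[reducible] noncomputable def d41Sat : SatakeDatum d41In.toData := univSat toyD41 toyD41_S_all

/-- Rogawski §4.5 on `toyD41` (by computation, not vacuous). -/
theorem d41_Sec4_5 : Hyp.Rogawski1990_Sec4_5_Unramified d41Sat := univ_Sec4_5 toyD41 toyD41_S_all

/-- Harris II (2.2.5)(b) on the core of `d41In`. -/
theorem d41_Harris_core : Hyp.HarrisII2007_Prop2_2_5_b_core d41In.toData := d41_Harris

/-- Rogawski §11.4 on the core of `d41In`. -/
theorem d41_Rogawski_core : Hyp.Rogawski1990_Sec11_4_BC_core d41In.toData := d41_Rogawski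

/-- The inert datum rebuilt on `toyD41` is `d41In`. -/
theorem d41_inertDatum_of_satake_eq :
    N41Place.inertDatum_of_satake d41In.toData d41Sat d41_Sec4_5 d41_Harris_core d41_Rogawski_core = d41In :=
  rfl

/-- The placement composed on `toyD41` through the Satake layer. -/
theorem d41_placement_kappa_satake : ∀ v ∉ toyD41.S, ∀ s : ℂ, toyD41.Lv v s = toyD41.g₁ v s * toyD41.g₂ v s :=
  N41Place.N41_placement_kappa_satake toyD41 d41Pl d41In.toData d41Sat d41_Sec4_5 d41_Harris_core
    d41_Rogawski_core d41Sp d41LQ d41Kd d41_LR7 d41_Bump d41_Minguez d41_Bump451 d41_Rao d41_dich d41_kappa'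

/-- The same composition stated on `N43Toy.bergmanNSide.d41` (the joint toy's sides). -/
theorem bergman_d41_placement_kappa_satake : ∀ v ∉ N43Toy.bergmanNSide.d41.S, ∀ s : ℂ,
    N43Toy.bergmanNSide.d41.Lv v s = N43Toy.bergmanNSide.d41.g₁ v s * N43Toy.bergmanNSide.d41.g₂ v s :=
  N41Place.N41_placement_kappa_satake N43Toy.bergmanNSide.d41 d41Pl d41In.toData d41Sat d41_Sec4_5
    d41_Harris_core d41_Rogawski_core d41Sp d41LQ d41Kd d41_LR7 d41_Bump d41_Minguez d41_Bump451 d41_Rao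
    d41_dich d41_kappa'

end N41PlaceUniv

end Summit.Ventures.HodgeRepro2.T6
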